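import Summits.QuantumFields.YangMills.Theorems.BalabanUVNodesN15TwoGridEntry1
import Summits.QuantumFields.YangMills.Theorems.BalabanUVNodesN15TwoGridReadout
import HarnessLib

/-!
# Route «BalabanUVNodes», node N15 = NE2, -a lane, part 60: THE NODE-VOCABULARY READOUT OF BAŁABAN's FULL PAIR `(G′, G)` AT `U ≡ 1` WITH THE HONEST ENTRY 1 —
# `T4EtaRate.NE2ZeroOperator` ∕ `NE2PlusOperator` BY NAME, entries 0, 1, 3 PROVED (parts 52∕59∕54), MODULO ENTRY 2 ONLY (one displayed binder)

Cell `pub-ymgap`, seat `pub-ymgap-dag-n15-a` (KNIT-BY-NAME, g13); `--supports stmt-QuantumFields-20507 --as helper` (this file declares one plumbing `def`, the entry-1 operator family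
`tgT1`, so the gate may route it to the definition lane like part 55).  Imports BY NAME part 59 (`hasMaj_twoGridDefect_grad`) and part 55 (`TGIndex`, `tgInstance`, `tgFamily`,
`ne2ZeroOperator_fullG_of_entries12`); nothing in the tree is modified.
WHAT.  (§76) `tgT1 d hL a ν i := idef P P (ρ′(n′(s_ν−1))∘G′) (ρ(n(s_ν−1))∘G)` — the HONEST entry-1 operator `𝔇(∇_νG) = ∇′_νG′P − P∇_νG` of [B9] (3.42) at the index `i` (King's
prolongation on both sides, `n = L^k`, `n′ = L^m·L^k`), replacing part 55's free binder `T1`; `hasMaj_tgT1` (its uniform majorant `C·(L^k)^{−1∕16}·e^{−δ|y−y′|_T}`, part 59 with the cast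
`(L^k : ℕ) = (L : ℝ)^k`); `hasMaj_rescale` (common constants).  (§77) ★★ **`ne2ZeroOperator_fullG_of_entry2`**: for odd `L ≥ 3`, `a > 0`, a direction `ν`: IF the consumer's entry-2
operators `T2 i` (`𝔇(G∇*)`) have uniform majorants `B₂·(L^k)^{−γ₂}·e^{−δ₂|y−y′|_T}` (`γ₂, δ₂ > 0`), THEN `NE2ZeroOperator (tgInstance d hL) (tgFamily d hL a (tgT1 d hL a ν) T2)` — entries
0, 1, 3 are the theorems of parts 52, 59, 54; `ne2PlusOperator_fullG_of_entry2` (the node's FIRST CONJUNCT by name at the one-point carrier; the «+» block inert there — said).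
HONEST FRAMING ∕ LIMITS.  A READOUT over parts 52∕54∕59: ONE displayed binder remains — ENTRY 2 `𝔇(G∇*)` (the derivative on the ROUGH coarse source; no sup-only route exists in the
tree's block-majorant currency; located TRUE route: an L²-block `BlockNorm` + Bałaban's (1.114) + L² duality `Pᵀ = Q_m`; a vacuous `T2 = 0` satisfies the binder — said).  `U ≡ 1`
torus family of record; one-point background carrier; the [B9] size parameter `M` of the realised geometries is INERT (`= 1`); the entry-1 operator is for ONE direction `ν` per family
(the four (3.42) entries are typed as a `Fin 4`-family in `T4EtaRate`; all directions have the same constants); count-neutral (typed 28∕28 · discharged 5∕27 of record unchanged); NOT a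
discharge of N15 (object-bound; NE2⁺ NOT PRINTED); one finite T⁴ at fixed ε — NOT infinite volume, NOT OS on ℝ⁴, NOT a mass gap, NOT Clay.
-/

noncomputable section

open scoped BigOperators
open Finset

namespace Summit.QuantumFields.YangMills.BalabanUVNodes.N15.TwoGrid

open Literature.MathematicalPhysics.QuantumFieldTheory.Balaban1983to89
open Literature.MathematicalPhysics.QuantumFieldTheory.Balaban1983to89.B11SectG (BlockNorm HasMaj)
open Literature.MathematicalPhysics.QuantumFieldTheory.Balaban1983to89.T4EtaRate (PairedInstance EtaPairing EtaRateIneq342 NE2PlusOperator NE2ZeroOperator)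
open Literature.MathematicalPhysics.QuantumFieldTheory.Balaban1983to89.T4EtaRateDefect (idef)
open Literature.MathematicalPhysics.QuantumFieldTheory.Balaban1983to89.T4EtaRateCoeffDefect (pull pull_apply)
open Literature.MathematicalPhysics.QuantumFieldTheory.Balaban1983to89.B5Prop11Plancherel (Tor fine)
open Literature.MathematicalPhysics.QuantumFieldTheory.Balaban1983to89.B5SiteBridgeP12 (MP)
open Literature.MathematicalPhysics.QuantumFieldTheory.Balaban1983to89.B6UnitTorusCarrier (unitTorusGeo)
open Literature.MathematicalPhysics.QuantumFieldTheory.King1986.Torus (blockOf tdistT tdistT_nonneg)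
open Summit.QuantumFields.YangMills.BalabanUVNodes.N15.VectorPiece (blkFine kingPrV)

variable {d : ℕ} {L : ℕ} [NeZero L]

/-! ## §76 The honest entry-1 operator family and its uniform majorant -/

/-- **THE ENTRY-1 OPERATOR FAMILY** `𝔇(∇_νG) = ∇′_νG′P − P∇_νG` of [B9] (3.42) for the pair `(G′, G) = (gOp M (L^m·L^k) a, gOp M (L^k) a)` at the index `i` of the torus family of record,
direction `ν` (King's prolongation `P` on both sides; forward difference quotients with the lattice factors `n′ = L^m·L^k`, `n = L^k`).
[cite: Balaban1985BackgroundPropagators, (3.42) p.397 (the entry ∇G)] -/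
def tgT1 (d : ℕ) (hL : Odd L ∧ 1 < L) (a : ℝ) (ν : Fin (d + 1)) (i : TGIndex) :
    (Tor (fine (L ^ i.k) (TGIndex.Mn d hL i)) × Fin (d + 1) → ℝ) →ₗ[ℝ] (Tor (fine (L ^ i.m * L ^ i.k) (TGIndex.Mn d hL i)) × Fin (d + 1) → ℝ) :=
  idef (pull (kingPrV L i.k i.m (TGIndex.Mn d hL i))) (pull (kingPrV L i.k i.m (TGIndex.Mn d hL i)))
    (symbOp (TGIndex.Mn d hL i) (L ^ i.m * L ^ i.k) (sD (TGIndex.Mn d hL i) (L ^ i.m * L ^ i.k) ν ((L ^ i.m * L ^ i.k : ℕ) : ℝ)) ∘ₗ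
      gOp (TGIndex.Mn d hL i) (L ^ i.m * L ^ i.k) a)
    (symbOp (TGIndex.Mn d hL i) (L ^ i.k) (sD (TGIndex.Mn d hL i) (L ^ i.k) ν ((L ^ i.k : ℕ) : ℝ)) ∘ₗ gOp (TGIndex.Mn d hL i) (L ^ i.k) a)

omit [NeZero L] in
/-- rescaling a majorant `B·(L^k)^{−γ}·e^{−δd}` to WEAKER common constants `B′ ≥ B`, `γ′ ≤ γ`, `δ′ ≤ δ` (`B′ ≥ 0`, `L ≥ 1`). [folklore] -/
theorem hasMaj_rescale {M : Fin (d + 1) → ℕ} [∀ μ, NeZero (M μ)] {k : ℕ} {F₁ F₂ : Type} [AddCommGroup F₁] [Module ℝ F₁] [AddCommGroup F₂] [Module ℝ F₂]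
    {b₁ : BlockNorm (unitTorusGeo L k M) F₁} {b₂ : BlockNorm (unitTorusGeo L k M) F₂} {T : F₁ →ₗ[ℝ] F₂} {B B' γ γ' δ δ' : ℝ}
    (hL1 : (1 : ℝ) ≤ (L : ℝ)) (hB' : 0 ≤ B') (hB : B ≤ B') (hγ : γ' ≤ γ) (hδ : δ' ≤ δ)
    (h : HasMaj b₁ b₂ T (fun y y' => B * ((L : ℝ) ^ k) ^ (-γ) * Real.exp (-(δ * tdistT M y y')))) :
    HasMaj b₁ b₂ T (fun y y' => B' * ((L : ℝ) ^ k) ^ (-γ') * Real.exp (-(δ' * tdistT M y y'))) := by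
  have hx1 : (1 : ℝ) ≤ (L : ℝ) ^ k := one_le_pow₀ hL1
  refine h.mono fun y y' => ?_
  have hrate : ((L : ℝ) ^ k) ^ (-γ) ≤ ((L : ℝ) ^ k) ^ (-γ') := Real.rpow_le_rpow_of_exponent_le hx1 (neg_le_neg hγ)
  have hexp : Real.exp (-(δ * tdistT M y y')) ≤ Real.exp (-(δ' * tdistT M y y')) := Real.exp_le_exp.mpr (by nlinarith [tdistT_nonneg M y y'])
  by_cases hB0 : 0 ≤ B
  · exact mul_le_mul (mul_le_mul hB hrate (Real.rpow_nonneg (by positivity) _) hB') hexp (Real.exp_nonneg _) (mul_nonneg hB' (Real.rpow_nonneg (by positivity) _))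
  · exact (mul_nonpos_of_nonpos_of_nonneg (mul_nonpos_of_nonpos_of_nonneg (le_of_lt (not_le.mp hB0)) (Real.rpow_nonneg (by positivity) _)) (Real.exp_nonneg _)).trans
      (mul_nonneg (mul_nonneg hB' (Real.rpow_nonneg (by positivity) _)) (Real.exp_nonneg _))

/-- **THE UNIFORM MAJORANT OF THE ENTRY-1 FAMILY** (part 59 `hasMaj_twoGridDefect_grad`, with `(L^k : ℕ) = (L : ℝ)^k`): for odd `L ≥ 3`, `a > 0`, a direction `ν`, there are `δ, C > 0` such that
at EVERY index `C·(L^k)^{−1∕16}·e^{−δ|y−y′|_T}` majorises `tgT1 d hL a ν i`. [cite: Balaban1985BackgroundPropagators, Thm 3.1 (3.42) p.397 (shape); King1986, Prop. 3.9 (3.73) p.665 (η-rate shape)] -/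
theorem hasMaj_tgT1 (hLodd : Odd L) (hL2 : 2 ≤ L) (hL : Odd L ∧ 1 < L) {a : ℝ} (ha : 0 < a) (ν : Fin (d + 1)) :
    ∃ δ C : ℝ, 0 < δ ∧ 0 < C ∧ ∀ i : TGIndex,
      HasMaj (BlockNorm.ofBlocks (unitTorusGeo L i.k (TGIndex.Mn d hL i)) (blkFine L i.k (TGIndex.Mn d hL i)))
        (BlockNorm.ofBlocks (unitTorusGeo L i.k (TGIndex.Mn d hL i))
          (fun j : Tor (fine (L ^ i.m * L ^ i.k) (TGIndex.Mn d hL i)) × Fin (d + 1) => blockOf (L ^ i.m * L ^ i.k) (TGIndex.Mn d hL i) j.1)) (tgT1 d hL a ν i)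
        (fun y y' => C * ((L : ℝ) ^ i.k) ^ (-(1 / 16 : ℝ)) * Real.exp (-(δ * tdistT (TGIndex.Mn d hL i) y y'))) := by
  obtain ⟨δ, C, hδ, hC, H⟩ := hasMaj_twoGridDefect_grad (d := d) hLodd hL2 ha
  refine ⟨δ, C, hδ, hC, fun i => ?_⟩
  have hcast : ((L ^ i.k : ℕ) : ℝ) = (L : ℝ) ^ i.k := by push_cast; ring
  refine (H i.mT i.k i.m i.one_le hL ν).mono fun y y' => le_of_eq ?_
  rw [hcast]
  rfl

/-! ## §77 ★★ The readout MODULO ENTRY 2 ONLY -/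

/-- ★★ **NE2⁰, OPERATOR LAYER, FOR BAŁABAN's FULL LANDAU-GAUGE PAIR `(G′, G)` AT `U ≡ 1` — BY NAME, ENTRIES 0, 1, 3 PROVED, MODULO ENTRY 2.**  For odd `L ≥ 3`, `a > 0` and a direction `ν`:
if the consumer's entry-2 operators `T2 i` (`𝔇(G∇*)` of the pair) have block majorants `B₂·(L^k)^{−γ₂}·e^{−δ₂|y−y′|_T}` with UNIFORM `B₂`, `γ₂ > 0`, `δ₂ > 0`, then the realised paired-instance
family of the torus family of record, with the HONEST entry-1 operators `tgT1 d hL a ν`, satisfies `T4EtaRate.NE2ZeroOperator` BY NAME — entries 0 and 3 are parts 52∕54 (inside part 55's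
readout), entry 1 is part 59's `hasMaj_twoGridDefect_grad`; nothing else is assumed.
[cite: Balaban1985BackgroundPropagators, Thm 3.1 (3.42) p.397 (shape); King1986, Props. 3.8–3.9 (3.71)–(3.75) pp.664–665 (A = 0 model)] -/
theorem ne2ZeroOperator_fullG_of_entry2 (hLodd : Odd L) (hL2 : 2 ≤ L) (hL : Odd L ∧ 1 < L) {a : ℝ} (ha : 0 < a) (ν : Fin (d + 1))
    (T2 : ∀ i : TGIndex, (Tor (fine (L ^ i.k) (TGIndex.Mn d hL i)) × Fin (d + 1) → ℝ) →ₗ[ℝ] (Tor (fine (L ^ i.m * L ^ i.k) (TGIndex.Mn d hL i)) × Fin (d + 1) → ℝ))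
    {B₂ γ₂ δ₂ : ℝ} (hγ₂ : 0 < γ₂) (hδ₂ : 0 < δ₂)
    (h2 : ∀ i : TGIndex, HasMaj (BlockNorm.ofBlocks (unitTorusGeo L i.k (TGIndex.Mn d hL i)) (blkFine L i.k (TGIndex.Mn d hL i)))
      (BlockNorm.ofBlocks (unitTorusGeo L i.k (TGIndex.Mn d hL i))
        (fun j : Tor (fine (L ^ i.m * L ^ i.k) (TGIndex.Mn d hL i)) × Fin (d + 1) => blockOf (L ^ i.m * L ^ i.k) (TGIndex.Mn d hL i) j.1)) (T2 i)
      (fun y y' => B₂ * ((L : ℝ) ^ i.k) ^ (-γ₂) * Real.exp (-(δ₂ * tdistT (TGIndex.Mn d hL i) y y')))) :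
    NE2ZeroOperator (tgInstance d hL) (tgFamily d hL a (tgT1 d hL a ν) T2) := by
  obtain ⟨δ₁, C₁, hδ₁, hC₁, H1⟩ := hasMaj_tgT1 (d := d) hLodd hL2 hL ha ν
  have hL1 : (1 : ℝ) ≤ (L : ℝ) := by exact_mod_cast (show 1 ≤ L by omega)
  have hB : 0 ≤ max C₁ B₂ := hC₁.le.trans (le_max_left _ _)
  refine ne2ZeroOperator_fullG_of_entries12 (d := d) hLodd hL2 hL ha (tgT1 d hL a ν) T2 (B₁ := max C₁ B₂) (γ₁ := min (1 / 16) γ₂) (δ₁ := min δ₁ δ₂)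
    (lt_min (by norm_num) hγ₂) (lt_min hδ₁ hδ₂) (fun i => ?_) (fun i => ?_)
  · exact hasMaj_rescale hL1 hB (le_max_left _ _) (min_le_left _ _) (min_le_left _ _) (H1 i)
  · exact hasMaj_rescale hL1 hB (le_max_right _ _) (min_le_right _ _) (min_le_right _ _) (h2 i)

/-- **NE2⁺, OPERATOR LAYER (the node's FIRST CONJUNCT `T4EtaRate.NE2PlusOperator` BY NAME) FOR THE PAIR `(G′, G)` WITH THE HONEST ENTRY 1 — MODULO ENTRY 2**, at the one-point background
carrier (the regularity condition (3.35) is VOID there: the «+» block is inert, the content is NE2⁰'s — said, as for parts 17∕55). [cite: Balaban1985BackgroundPropagators, Thm 3.1 p.397 (quantifier template)] -/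
theorem ne2PlusOperator_fullG_of_entry2 (hLodd : Odd L) (hL2 : 2 ≤ L) (hL : Odd L ∧ 1 < L) {a : ℝ} (ha : 0 < a) (c35 : ℝ) (ν : Fin (d + 1))
    (T2 : ∀ i : TGIndex, (Tor (fine (L ^ i.k) (TGIndex.Mn d hL i)) × Fin (d + 1) → ℝ) →ₗ[ℝ] (Tor (fine (L ^ i.m * L ^ i.k) (TGIndex.Mn d hL i)) × Fin (d + 1) → ℝ))
    {B₂ γ₂ δ₂ : ℝ} (hγ₂ : 0 < γ₂) (hδ₂ : 0 < δ₂)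
    (h2 : ∀ i : TGIndex, HasMaj (BlockNorm.ofBlocks (unitTorusGeo L i.k (TGIndex.Mn d hL i)) (blkFine L i.k (TGIndex.Mn d hL i)))
      (BlockNorm.ofBlocks (unitTorusGeo L i.k (TGIndex.Mn d hL i))
        (fun j : Tor (fine (L ^ i.m * L ^ i.k) (TGIndex.Mn d hL i)) × Fin (d + 1) => blockOf (L ^ i.m * L ^ i.k) (TGIndex.Mn d hL i) j.1)) (T2 i)
      (fun y y' => B₂ * ((L : ℝ) ^ i.k) ^ (-γ₂) * Real.exp (-(δ₂ * tdistT (TGIndex.Mn d hL i) y y')))) :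
    NE2PlusOperator c35 (tgInstance d hL) (tgFamily d hL a (tgT1 d hL a ν) T2) := by
  obtain ⟨M₅, δ₀, B₀, γ₀, hM₅, hδ₀, hB₀, hγ₀, H⟩ := ne2ZeroOperator_fullG_of_entry2 (d := d) hLodd hL2 hL ha ν T2 hγ₂ hδ₂ h2
  exact ⟨M₅, δ₀, 1, B₀, γ₀, hM₅, hδ₀, one_pos, hB₀, hγ₀, fun i hM _ _ _ U _ => by cases U; exact H i hM⟩

end Summit.QuantumFields.YangMills.BalabanUVNodes.N15.TwoGrid
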